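import Summits.RiemannHypothesis.RiemannHypothesis.Theses.WeilComb

/-!
# `WeilComb.CombShapeAdmissible` (item stmt-RiemannHypothesis-11231): the fixed bump is a Weil test

Support item of route `RiemannHypothesis/WeilComb`: the fixed comb shape
`φ₀ : u ↦ exp(−1/(1−u²))·1_{|u|<1}`, written `expNegInvGlue (1 - u ^ 2)` and coerced to `ℂ`, is a
Weil test (`IsWeilTest`: `C^∞` with compact support) and `tsupport φ₀ ⊆ [-1, 1]`.

Proof: off `[-1, 1]` one has `1 - u² ≤ 0`, so `φ₀ u = 0` (`expNegInvGlue.zero_of_nonpos`); hence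
`support φ₀ ⊆ [-1, 1]`, so `tsupport φ₀ ⊆ [-1, 1]` (`closure_minimal`, `[-1, 1]` closed) and `φ₀`
has compact support (`HasCompactSupport.of_support_subset_isCompact`).  Smoothness is
`expNegInvGlue.contDiff` composed with the polynomial `u ↦ 1 - u²` and with the real-linear coercion
`Complex.ofRealCLM`.  This makes `CombSubcritical` / `CombConverse` (stated for an arbitrary Weil
test `φ` with `tsupport φ ⊆ [-1, 1]`) apply to the fixed-shape combs of `CombShapePositivity`.
Nothing here is specific to the Weil functional.
-/

noncomputable section

namespace Summit.RiemannHypothesis.RiemannHypothesis.Theorems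

open Literature.NumberTheory.LFunctions
open Summit.RiemannHypothesis.RiemannHypothesis.Theses.WeilComb

/-- The fixed bump `u ↦ (expNegInvGlue (1 - u²) : ℂ)` vanishes off `[-1, 1]`, i.e. its support
lies in `Set.Icc (-1) 1`: for `u ∉ [-1, 1]`, `1 - u² ≤ 0` and `expNegInvGlue` vanishes on
`(-∞, 0]`. [folklore] -/
theorem weilComb_shapeBump_support_subset :
    Function.support (fun u : ℝ => ((expNegInvGlue (1 - u ^ 2) : ℝ) : ℂ)) ⊆ Set.Icc (-1) 1 := by
  intro u hu
  by_contra h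
  apply hu
  have h1 : 1 - u ^ 2 ≤ 0 := by
    simp only [Set.mem_Icc, not_and_or, not_le] at h
    rcases h with h | h <;> nlinarith
  simp [expNegInvGlue.zero_of_nonpos h1]

/-- The fixed bump `u ↦ (expNegInvGlue (1 - u²) : ℂ)` has `tsupport ⊆ [-1, 1]` (closure of the
support inside the closed interval). [folklore] -/
theorem weilComb_shapeBump_tsupport_subset :
    tsupport (fun u : ℝ => ((expNegInvGlue (1 - u ^ 2) : ℝ) : ℂ)) ⊆ Set.Icc (-1) 1 :=
  closure_minimal weilComb_shapeBump_support_subset isClosed_Icc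

/-- The fixed bump `u ↦ (expNegInvGlue (1 - u²) : ℂ)` is a Weil test: smooth (composition of the
smooth `expNegInvGlue` with `u ↦ 1 - u²` and the coercion `ℝ → ℂ`) with compact support (support
inside the compact interval `[-1, 1]`). [folklore] -/
theorem weilComb_shapeBump_isWeilTest :
    IsWeilTest (fun u : ℝ => ((expNegInvGlue (1 - u ^ 2) : ℝ) : ℂ)) := by
  refine ⟨?_, ?_⟩
  · exact Complex.ofRealCLM.contDiff.comp
      (expNegInvGlue.contDiff.comp (contDiff_const.sub (contDiff_id.pow 2)))
  · exact HasCompactSupport.of_support_subset_isCompact isCompact_Icc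
      weilComb_shapeBump_support_subset

/-- **`CombShapeAdmissible`** (item stmt-RiemannHypothesis-11231 of route `WeilComb`): the fixed
shape `φ₀ = (u ↦ expNegInvGlue (1 - u²) : ℝ → ℂ)` is a Weil test and `tsupport φ₀ ⊆ [-1, 1]`.
[folklore] -/
theorem combShapeAdmissible_proof : CombShapeAdmissible := by
  unfold CombShapeAdmissible
  exact ⟨weilComb_shapeBump_isWeilTest, weilComb_shapeBump_tsupport_subset⟩

end Summit.RiemannHypothesis.RiemannHypothesis.Theorems

end
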